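import Summits.QuantumAdvantage.QuantumAdvantage.Theorems.CubicForrelationNearExactIsExactTwelveTypeO934Shape

/-!
# Crux `CubicForrelation.NearExactIsExact` (stmt-QuantumAdvantage-14043) — n = 12, type O at `Φ ≥ 934/1024`: the wild set

Certificate seat `b2b-cforr-cert` (gen 18).  HONEST FRAMING: kernel-checked lemmas (standard axioms) for the type-O branch of the rung `934/1024`
of the finite slice `n = 12`; NO new value of `θ₁₂` in this file.  NOT summit progress.

Setting (as in `to18_typeO_ge935_rigid`): `W_g = 16u`, `u` odd everywhere, affine digit `d₁` with `(−1)^{d₁(x)} = (−1)^{b₁}(−1)^{c₁·x}`, cubic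
digit `d₂`, base set `E = {d₁ = d₂}`, `u − 4(−1)^f = τ₀ + 8v` with `τ₀ = (−1)^{d₁}(1 − 4·1_E) ∈ {±1, ±3}`, partner `W_f = 16u_f`.
* `to18_typeO_partner_identity`: Walsh inversion — `64u_f(y) = 256(−1)^{g(y)} − (−1)^{b₁}(4096·[c₁ = y] − 4Ê(c₁ ⊕ y)) − 8v̂(y)`.
* `to18_typeO_vhat_dvd8`: with `#E = 912`, `v̂(y) ∈ 8ℤ` for every `y` (half weights of `E` are cubic weights on 11 bits, `∈ 8ℤ`).
* `to18_typeO_ge934_wild`: at `Φ ≥ 934/1024` (`#E = 912`, excess `≤ 128` by `to18_typeO_ge934_shape`): `|v| ≤ 1` pointwise, `v ≢ 0`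
  (else `Φ = 935/1024`, dead by `to18_typeO_ge935_false`), Parseval + `v̂ ∈ 8ℤ` give `Σv² ≥ 8`, and the excess `Σ 16v(τ₀ + 4v) ≥ 16Σv²`
  forces equality: `Σ v² = 8` and on the support `τ₀ = −3v`, i.e. the support lies in `E` and `v = (−1)^{b₁}(−1)^{c₁·x}` there.
The sequel (`TwelveTypeO934`) turns this into two periods of `E` and contradicts `to18_no_two_periods_912`.
References: Ax (1964) / McEliece (1972); MacWilliams–Sloane (1977) Ch. 15.  Axioms: the standard three.
-/

set_option linter.dupNamespace false -- D-0017: single-problem summit ⇒ `QuantumAdvantage.QuantumAdvantage` by design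

noncomputable section

namespace Summit.QuantumAdvantage.QuantumAdvantage.Theorems.CubicForrelation.NearExactIsExact

open Finset
open Literature.Computability.QuantumComplexity
open Literature.Computability.QuantumComplexity.BuzetChailloux (bxor zeroVec bxor_bxor_cancel_left bxor_zeroVec zeroVec_bxor bxor_comm
  bxor_self twist_zeroVec_right twist_bxor_right signOf_sq)
open Literature.Computability.QuantumComplexity.DerivativeWalsh (W sum_W_sq)
open Literature.Computability.QuantumComplexity.Simon (twist_eq_one_or)
open Summit.QuantumAdvantage.QuantumAdvantage.Theorems.NearExactIsExact.Negative (TypeOTwelve.typeO_of_exists_odd)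

/-! ### The partner identity -/

/-- **Partner identity (Walsh inversion at the Ax level).**  With `W_g = 16u`, `u − 4(−1)^f = τ₀ + 8v`, the affine digit in character form and
`W_f = 16u_f`: `64u_f(y) = 256(−1)^{g(y)} − (−1)^{b₁}(2¹²[c₁ ⊕ y = 0] − 4 Σ_{x∈E}(−1)^{x·(c₁⊕y)}) − 8 Σ_x v(x)(−1)^{x·y}`.  NOT summit progress.
[this work] -/
theorem to18_typeO_partner_identity (f g : (Fin (6 + 6) → Bool) → Bool)
    (u : (Fin (6 + 6) → Bool) → ℤ) (hu : ∀ x, W (fun y => signOf (g y)) x = (2 : ℝ) ^ 4 * (u x : ℝ))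
    (v : (Fin (6 + 6) → Bool) → ℤ)
    (hv : ∀ x, u x - 4 * sZ (f x) =
      sZ (decide (Odd (u x / 2))) * (1 - 4 * (if (Odd (u x / 2) ↔ Odd (u x / 2 / 2)) then 1 else 0)) + 8 * v x)
    (c₁ : Fin (6 + 6) → Bool) (b₁ : Bool) (hcb : ∀ x, signOf (decide (Odd (u x / 2))) = signOf b₁ * twist c₁ x)
    (uf : (Fin (6 + 6) → Bool) → ℤ) (huf : ∀ y, W (fun x => signOf (f x)) y = (2 : ℝ) ^ 4 * (uf y : ℝ))
    (y : Fin (6 + 6) → Bool) :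
    64 * (uf y : ℝ) = 256 * signOf (g y) -
      signOf b₁ * ((if bxor c₁ y = (fun _ => false) then (2 : ℝ) ^ (6 + 6) else 0) -
        4 * ∑ x ∈ univ.filter (fun x : Fin (6 + 6) → Bool => (Odd (u x / 2) ↔ Odd (u x / 2 / 2))), twist x (bxor c₁ y)) -
      8 * ∑ x, (v x : ℝ) * twist x y := by
  classical
  have hτ₀R : ∀ x, (((sZ (decide (Odd (u x / 2))) * (1 - 4 * (if (Odd (u x / 2) ↔ Odd (u x / 2 / 2)) then 1 else 0)) : ℤ)) : ℝ) =
      signOf b₁ * twist c₁ x * (1 - 4 * (if (Odd (u x / 2) ↔ Odd (u x / 2 / 2)) then 1 else 0)) := by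
    intro x
    push_cast
    rw [tp_sZ_cast, hcb x]
  have hinvg : ∑ x, (u x : ℝ) * twist x y = 256 * signOf (g y) := by
    have h := tz_inversion (fun y => signOf (g y)) y
    rw [sum_congr rfl fun x _ => by rw [hu x]] at h
    have h' : (2 : ℝ) ^ 4 * ∑ x, (u x : ℝ) * twist x y = 2 ^ (6 + 6) * signOf (g y) := by
      rw [mul_sum]; rw [← h]; exact sum_congr rfl fun x _ => by ring
    have e16 : (2 : ℝ) ^ (6 + 6) = 2 ^ 4 * 256 := by norm_num
    rw [e16, mul_assoc] at h'
    exact mul_left_cancel₀ (by positivity) h'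
  have h64 : 64 * (uf y : ℝ) = 256 * signOf (g y) -
      ∑ x, signOf b₁ * twist c₁ x * (1 - 4 * (if (Odd (u x / 2) ↔ Odd (u x / 2 / 2)) then 1 else 0)) * twist x y -
      8 * ∑ x, (v x : ℝ) * twist x y := by
    have hW4 : 4 * W (fun x => signOf (f x)) y = ∑ x, 4 * (signOf (f x) * twist x y) := by unfold W; rw [mul_sum]
    have e64 : 64 * (uf y : ℝ) = 4 * W (fun x => signOf (f x)) y := by rw [huf y]; ring
    rw [e64, hW4, mul_sum, ← hinvg, ← sum_sub_distrib, ← sum_sub_distrib]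
    refine sum_congr rfl fun x _ => ?_
    have h' : ((u x : ℤ) : ℝ) - 4 * (sZ (f x) : ℝ) =
        signOf b₁ * twist c₁ x * (1 - 4 * (if (Odd (u x / 2) ↔ Odd (u x / 2 / 2)) then 1 else 0)) + 8 * (v x : ℝ) := by
      rw [← hτ₀R x]; exact_mod_cast hv x
    rw [tp_sZ_cast] at h'
    have : (4 : ℝ) * signOf (f x) =
        (u x : ℝ) - signOf b₁ * twist c₁ x * (1 - 4 * (if (Odd (u x / 2) ↔ Odd (u x / 2 / 2)) then 1 else 0)) - 8 * (v x : ℝ) := by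
      linarith
    rw [show (4 : ℝ) * (signOf (f x) * twist x y) = (4 * signOf (f x)) * twist x y by ring, this]; ring
  have hτ₀sum : ∑ x, signOf b₁ * twist c₁ x * (1 - 4 * (if (Odd (u x / 2) ↔ Odd (u x / 2 / 2)) then 1 else 0)) * twist x y =
      signOf b₁ * ((if bxor c₁ y = (fun _ => false) then (2 : ℝ) ^ (6 + 6) else 0) -
        4 * ∑ x ∈ univ.filter (fun x : Fin (6 + 6) → Bool => (Odd (u x / 2) ↔ Odd (u x / 2 / 2))), twist x (bxor c₁ y)) := by
    have e1 : ∀ x, signOf b₁ * twist c₁ x * (1 - 4 * (if (Odd (u x / 2) ↔ Odd (u x / 2 / 2)) then 1 else 0)) * twist x y =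
        signOf b₁ * twist x (bxor c₁ y) -
          signOf b₁ * (4 * (if (Odd (u x / 2) ↔ Odd (u x / 2 / 2)) then twist x (bxor c₁ y) else 0)) := by
      intro x
      rw [twist_bxor_right, twist_comm x c₁]; split_ifs <;> ring
    rw [sum_congr rfl fun x _ => e1 x, sum_sub_distrib, ← mul_sum, ← mul_sum, ← mul_sum, tz_sum_twist_left, ← sum_filter]
    ring
  rw [h64, hτ₀sum]

/-! ### `v̂ ∈ 8ℤ` when `#E = 912` -/

/-- **`v̂(y) ∈ 8ℤ`** for a type-O side with `#E = 912`: in the partner identity the character sum over `E` is `≡ 912 (mod 16)`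
(`to18_char_sum_mod16`), and everything else is a multiple of `64`.  NOT summit progress. [this work] -/
theorem to18_typeO_vhat_dvd8 (f g : (Fin (6 + 6) → Bool) → Bool) (hg : IsDegLeFun 3 g)
    (u : (Fin (6 + 6) → Bool) → ℤ) (hu : ∀ x, W (fun y => signOf (g y)) x = (2 : ℝ) ^ 4 * (u x : ℝ)) (hodd : ∃ x, Odd (u x))
    (hE : #(univ.filter fun x : Fin (6 + 6) → Bool => (Odd (u x / 2) ↔ Odd (u x / 2 / 2))) = 912)
    (v : (Fin (6 + 6) → Bool) → ℤ)
    (hv : ∀ x, u x - 4 * sZ (f x) =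
      sZ (decide (Odd (u x / 2))) * (1 - 4 * (if (Odd (u x / 2) ↔ Odd (u x / 2 / 2)) then 1 else 0)) + 8 * v x)
    (c₁ : Fin (6 + 6) → Bool) (b₁ : Bool) (hcb : ∀ x, signOf (decide (Odd (u x / 2))) = signOf b₁ * twist c₁ x)
    (uf : (Fin (6 + 6) → Bool) → ℤ) (huf : ∀ y, W (fun x => signOf (f x)) y = (2 : ℝ) ^ 4 * (uf y : ℝ))
    (y : Fin (6 + 6) → Bool) :
    ∃ K : ℤ, ∑ x, (v x : ℝ) * twist x y = 8 * (K : ℝ) := by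
  classical
  have hall : ∀ x, Odd (u x) := TypeOTwelve.typeO_of_exists_odd g u hg hu hodd
  have hu' : ∀ x, W (fun y => signOf (g y)) x = (2 : ℝ) ^ (2 * 2) * (u x : ℝ) := fun x => (hu x).trans (by norm_num)
  have hd1 : IsDegLeFun 1 (fun x => decide (Odd (u x / 2))) := z2_digitOne 2 g u hg hu' hall
  have hd2 : IsDegLeFun 3 (fun x => decide (Odd (u x / 2 / 2))) := z2_digitTwo 2 g u hg hu' hall
  have hdegE : IsDegLeFun (2 + 1) (fun x => (decide (Odd (u x / 2)) ^^ decide (Odd (u x / 2 / 2))) ^^ true) :=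
    tb_isDegLeFun_xor_const (bb_isDegLeFun_bxor (hd1.mono (by norm_num)) hd2) true
  have hsetE : (univ.filter fun x : Fin (6 + 6) → Bool => ((decide (Odd (u x / 2)) ^^ decide (Odd (u x / 2 / 2))) ^^ true) = true) =
      univ.filter fun x : Fin (6 + 6) → Bool => (Odd (u x / 2) ↔ Odd (u x / 2 / 2)) := by
    apply filter_congr
    intro x _
    by_cases h1 : Odd (u x / 2) <;> by_cases h2 : Odd (u x / 2 / 2) <;> simp [h1, h2]
  obtain ⟨m, hm⟩ := to18_char_sum_mod16 _ hdegE (bxor c₁ y)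
  rw [hsetE, hE] at hm
  have h := to18_typeO_partner_identity f g u hu v hv c₁ b₁ hcb uf huf y
  rw [hm] at h
  have hsg : signOf (g y) = (sZ (g y) : ℝ) := (tp_sZ_cast _).symm
  have hsb : signOf b₁ = (sZ b₁ : ℝ) := (tp_sZ_cast _).symm
  have hsb2 : (sZ b₁ : ℝ) * sZ b₁ = 1 := by rcases tp_sZ_cases b₁ with h' | h' <;> rw [h'] <;> norm_num
  rw [hsg, hsb] at h
  by_cases h0 : bxor c₁ y = (fun _ => false)
  · rw [if_pos h0] at h
    refine ⟨4 * sZ (g y) - 7 * sZ b₁ - sZ b₁ * m - uf y, ?_⟩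
    push_cast
    norm_num at h
    linear_combination (1 / 8 : ℝ) * h
  · rw [if_neg h0] at h
    refine ⟨4 * sZ (g y) + 57 * sZ b₁ - sZ b₁ * m - uf y, ?_⟩
    push_cast
    norm_num at h
    linear_combination (1 / 8 : ℝ) * h

/-! ### The wild set at `Φ ≥ 934/1024` -/

/-- **The wild set of a type-O side at `Φ ≥ 934/1024`.**  With the notation of the module docstring: `Σ_x v(x)² = 8`, and for every `x` either
`v(x) = 0`, or `x ∈ E` and `v(x) = (−1)^{b₁}(−1)^{c₁·x}`.  NOT summit progress. [this work] -/
theorem to18_typeO_ge934_wild (f g : (Fin (6 + 6) → Bool) → Bool) (hf : IsDegLeFun 3 f) (hg : IsDegLeFun 3 g)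
    (u : (Fin (6 + 6) → Bool) → ℤ) (hu : ∀ x, W (fun y => signOf (g y)) x = (2 : ℝ) ^ 4 * (u x : ℝ))
    (hodd : ∃ x, Odd (u x)) (hΦ : (934 / 1024 : ℝ) ≤ forrelation f g)
    (v : (Fin (6 + 6) → Bool) → ℤ)
    (hv : ∀ x, u x - 4 * sZ (f x) =
      sZ (decide (Odd (u x / 2))) * (1 - 4 * (if (Odd (u x / 2) ↔ Odd (u x / 2 / 2)) then 1 else 0)) + 8 * v x)
    (c₁ : Fin (6 + 6) → Bool) (b₁ : Bool) (hcb : ∀ x, signOf (decide (Odd (u x / 2))) = signOf b₁ * twist c₁ x) :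
    (∑ x, v x ^ 2 = 8) ∧
      ∀ x, v x = 0 ∨ ((Odd (u x / 2) ↔ Odd (u x / 2 / 2)) ∧ (v x : ℝ) = signOf b₁ * twist c₁ x) := by
  classical
  obtain ⟨hE, hT⟩ := to18_typeO_ge934_shape f g hf hg u hu hodd hΦ
  have hall : ∀ x, Odd (u x) := TypeOTwelve.typeO_of_exists_odd g u hg hu hodd
  have hsumE : (∑ x, (if (Odd (u x / 2) ↔ Odd (u x / 2 / 2)) then 1 else 0 : ℤ)) = 912 := by rw [sum_boole, hE]; norm_num
  -- base pattern, excess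
  set τ₀ : (Fin (6 + 6) → Bool) → ℤ := fun x =>
    sZ (decide (Odd (u x / 2))) * (1 - 4 * (if (Odd (u x / 2) ↔ Odd (u x / 2 / 2)) then 1 else 0)) with hτ₀def
  have hvx : ∀ x, u x - 4 * sZ (f x) = τ₀ x + 8 * v x := fun x => hv x
  have hτ₀val : ∀ x, τ₀ x = 1 ∨ τ₀ x = -1 ∨ τ₀ x = 3 ∨ τ₀ x = -3 := by
    intro x
    simp only [τ₀]
    rcases tp_sZ_cases (decide (Odd (u x / 2))) with h | h <;> rw [h] <;> split_ifs <;> norm_num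
  have hτ₀sq : ∀ x, τ₀ x ^ 2 = 1 + 8 * (if (Odd (u x / 2) ↔ Odd (u x / 2 / 2)) then 1 else 0 : ℤ) := by
    intro x
    simp only [τ₀]
    rcases tp_sZ_cases (decide (Odd (u x / 2))) with h | h <;> rw [h] <;> split_ifs <;> norm_num
  have hsumτ₀ : ∑ x, τ₀ x ^ 2 = 11392 := by
    rw [sum_congr rfl fun x _ => hτ₀sq x, sum_add_distrib, ← mul_sum, hsumE, sum_const, card_univ, Fintype.card_fun,
      Fintype.card_bool, Fintype.card_fin]
    norm_num
  set X : (Fin (6 + 6) → Bool) → ℤ := fun x => (τ₀ x + 8 * v x) ^ 2 - τ₀ x ^ 2 with hXdef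
  have hXid : ∀ x, X x = 64 * v x ^ 2 + 16 * (v x * τ₀ x) := fun x => by simp only [X]; ring
  have hτ3 : ∀ x, -3 ≤ τ₀ x ∧ τ₀ x ≤ 3 := fun x => by rcases hτ₀val x with h | h | h | h <;> rw [h] <;> norm_num
  have hX16 : ∀ x, 16 * v x ^ 2 ≤ X x := by
    intro x
    have hprod : 0 ≤ v x * (3 * v x + τ₀ x) := by
      rcases lt_trichotomy (v x) 0 with h0 | h0 | h0
      · exact mul_nonneg_of_nonpos_of_nonpos h0.le (by linarith [hτ3 x])
      · rw [h0]; simp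
      · exact mul_nonneg h0.le (by linarith [hτ3 x])
    nlinarith [hXid x]
  have hTdec : (∑ x, (u x - 4 * sZ (f x)) ^ 2 : ℤ) = ∑ x, τ₀ x ^ 2 + ∑ x, X x := by
    rw [← sum_add_distrib]
    exact sum_congr rfl fun x _ => by rw [hvx x]; simp only [X]; ring
  have hXsum : ∑ x, X x ≤ 128 := by rw [hTdec, hsumτ₀] at hT; linarith
  have hXnn : ∀ x, 0 ≤ X x := fun x => le_trans (by positivity) (hX16 x)
  have hXle : ∀ x, X x ≤ 128 := fun x =>
    le_trans (single_le_sum (f := X) (fun y _ => hXnn y) (mem_univ x)) hXsum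
  -- `|v| ≤ 1` pointwise
  have hv1 : ∀ x, v x = 0 ∨ v x = 1 ∨ v x = -1 := by
    intro x
    rcases le_or_gt (v x) (-2) with h | h
    · exfalso
      have hA : 0 ≤ -2 - v x := by linarith
      have hB : 0 ≤ -(4 * v x + τ₀ x) - 5 := by linarith [hτ3 x]
      nlinarith [mul_nonneg hA hB, hXle x, hXid x, hτ3 x]
    rcases le_or_gt 2 (v x) with h' | h'
    · exfalso
      have hA : 0 ≤ v x - 2 := by linarith
      have hB : 0 ≤ 4 * v x + τ₀ x - 5 := by linarith [hτ3 x]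
      nlinarith [mul_nonneg hA hB, hXle x, hXid x, hτ3 x]
    omega
  -- `v ≢ 0`: otherwise `Φ = 935/1024`
  have hne : ∃ x, v x ≠ 0 := by
    by_contra h0
    push Not at h0
    have hX0 : ∑ x, X x = 0 := sum_eq_zero fun x _ => by simp only [X, h0 x]; ring
    have hT' : (∑ x, (u x - 4 * sZ (f x)) ^ 2 : ℤ) = 11392 := by rw [hTdec, hsumτ₀, hX0]; norm_num
    have hbud := tw12_budget f g u hu
    rw [hT'] at hbud
    push_cast at hbud
    exact to18_typeO_ge935_false f g hf hg u hu hodd (by linarith)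
  obtain ⟨x₀, hx₀⟩ := hne
  -- Parseval and `v̂ ∈ 8ℤ`: `Σ v² ≥ 8`
  obtain ⟨uf, huf⟩ := tw_base (n := 6 + 6) f hf 4 (by norm_num)
  have hParsv : ∑ y, W (fun x => (v x : ℝ)) y ^ 2 = 4096 * ∑ x, ((v x : ℝ)) ^ 2 := by rw [sum_W_sq]; norm_num
  have hWv : ∀ y, W (fun x => (v x : ℝ)) y = ∑ x, (v x : ℝ) * twist x y := fun y => rfl
  have hex : ∃ y, W (fun x => (v x : ℝ)) y ≠ 0 := by
    by_contra h0
    push Not at h0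
    have hz : ∑ y, W (fun x => (v x : ℝ)) y ^ 2 = 0 := sum_eq_zero fun y _ => by rw [h0 y]; ring
    rw [hParsv] at hz
    have hz' : ∑ x, ((v x : ℝ)) ^ 2 = 0 := by linarith
    have := (sum_eq_zero_iff_of_nonneg fun x _ => sq_nonneg ((v x : ℝ))).1 hz' x₀ (mem_univ _)
    exact hx₀ (by exact_mod_cast pow_eq_zero_iff (n := 2) (by norm_num) |>.1 this)
  obtain ⟨y₀, hy₀⟩ := hex
  obtain ⟨K, hK⟩ := to18_typeO_vhat_dvd8 f g hg u hu hodd hE v hv c₁ b₁ hcb uf huf y₀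
  rw [hWv y₀] at hy₀
  have hK0 : K ≠ 0 := fun h => hy₀ (by rw [hK, h]; simp)
  have habs : ∀ x, |(v x : ℝ)| = (v x : ℝ) ^ 2 := fun x => by
    rcases hv1 x with h | h | h <;> rw [h] <;> norm_num
  have h8le : (8 : ℝ) ≤ ∑ x, ((v x : ℝ)) ^ 2 := by
    have h1 : |∑ x, (v x : ℝ) * twist x y₀| ≤ ∑ x, ((v x : ℝ)) ^ 2 := by
      refine (abs_sum_le_sum_abs _ _).trans (le_of_eq (sum_congr rfl fun x _ => ?_))
      rw [abs_mul, habs x]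
      rcases twist_eq_one_or x y₀ with h | h <;> rw [h] <;> norm_num
    have h2 : (8 : ℝ) ≤ |∑ x, (v x : ℝ) * twist x y₀| := by
      rw [hK, abs_mul]
      have hK1 : (1 : ℝ) ≤ |(K : ℝ)| := by
        rw [← Int.cast_abs]; exact_mod_cast Int.one_le_abs hK0
      have : |(8 : ℝ)| = 8 := by norm_num
      rw [this]; nlinarith
    linarith
  have h8leZ : (8 : ℤ) ≤ ∑ x, v x ^ 2 := by exact_mod_cast h8le
  -- tightness
  have hX16sum : 16 * ∑ x, v x ^ 2 ≤ ∑ x, X x := by rw [mul_sum]; exact sum_le_sum fun x _ => hX16 x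
  have hv8 : ∑ x, v x ^ 2 = 8 := by linarith
  have htight : ∀ x, X x = 16 * v x ^ 2 := by
    have hsum0 : ∑ x, (X x - 16 * v x ^ 2) = 0 := by rw [sum_sub_distrib, ← mul_sum]; linarith
    intro x
    have := (sum_eq_zero_iff_of_nonneg fun y _ => sub_nonneg.2 (hX16 y)).1 hsum0 x (mem_univ _)
    linarith
  refine ⟨hv8, fun x => ?_⟩
  rcases hv1 x with h0 | h1 | h1
  · exact Or.inl h0
  all_goals
    right
    have hτv : τ₀ x = -3 * v x := by have := htight x; rw [hXid x, h1] at this; rw [h1]; linarith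
    have hxE : (Odd (u x / 2) ↔ Odd (u x / 2 / 2)) := by
      by_contra hn
      have := hτ₀sq x
      rw [if_neg hn, hτv, h1] at this
      norm_num at this
    refine ⟨hxE, ?_⟩
    have hτE : τ₀ x = -3 * sZ (decide (Odd (u x / 2))) := by simp only [τ₀]; rw [if_pos hxE]; ring
    have hvZ : v x = sZ (decide (Odd (u x / 2))) := by linarith
    rw [hvZ, tp_sZ_cast, hcb x]

end Summit.QuantumAdvantage.QuantumAdvantage.Theorems.CubicForrelation.NearExactIsExact

end
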